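import Mathlib

/-!
# Irreducible polynomials over an algebraically closed field stay irreducible under base change

Helper file for item stmt-Schanuel-0975 (`TwoLogsBranchRelationFinite`, route RigidCore):
a specialisation (Nullstellensatz) argument.
-/

noncomputable section

-- `Summit.Schanuel.Schanuel` is the tree's mandated `Summit.<Summit>.<Problem>` prefix (single-problem summit).
set_option linter.dupNamespace false

open MvPolynomial

namespace Summit.Schanuel.Schanuel.Theorems.RigidCore.TwoLogs

/-- **`F`-points avoiding a hypersurface.** A finitely generated domain over an algebraically
closed field `F` admits an `F`-algebra map to `F` not killing a given nonzero element
(Hilbert's Nullstellensatz / Zariski's lemma; folklore). -/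
theorem exists_algHom_apply_ne_zero {F A : Type*} [Field F] [IsAlgClosed F] [CommRing A]
    [IsDomain A] [Algebra F A] [Algebra.FiniteType F A] {c : A} (hc : c ≠ 0) :
    ∃ ψ : A →ₐ[F] F, ψ c ≠ 0 := by
  have hJ : IsJacobsonRing A := isJacobsonRing_of_finiteType (A := F)
  have hnot : c ∉ (⊥ : Ideal A).jacobson := by
    rw [← Ideal.radical_eq_jacobson]
    rintro ⟨n, hn⟩
    rw [Ideal.mem_bot] at hn
    exact hc (pow_eq_zero_iff'.mp hn).1
  have hnot' : ¬ ∀ m : Ideal A, m ∈ {J : Ideal A | ⊥ ≤ J ∧ J.IsMaximal} → c ∈ m := by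
    intro h
    exact hnot (Ideal.mem_sInf.mpr (fun {m} hm => h m hm))
  push Not at hnot'
  obtain ⟨m, ⟨-, hm⟩, hcm⟩ := hnot'
  letI : m.IsMaximal := hm
  letI : Field (A ⧸ m) := Ideal.Quotient.field m
  have hft : Algebra.FiniteType F (A ⧸ m) :=
    Algebra.FiniteType.of_surjective (Ideal.Quotient.mkₐ F m) (Ideal.Quotient.mkₐ_surjective F m)
  have hfin : Module.Finite F (A ⧸ m) := finite_of_finite_type_of_isJacobsonRing F (A ⧸ m)
  have halg : Algebra.IsAlgebraic F (A ⧸ m) := Algebra.IsAlgebraic.of_finite F (A ⧸ m)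
  let θ : (A ⧸ m) →ₐ[F] F := IsAlgClosed.lift
  refine ⟨θ.comp (Ideal.Quotient.mkₐ F m), ?_⟩
  intro h0
  have h1 : (Ideal.Quotient.mkₐ F m c) = 0 := by
    apply θ.toRingHom.injective
    simpa using h0
  rw [Ideal.Quotient.mkₐ_eq_mk, Ideal.Quotient.eq_zero_iff_mem] at h1
  exact hcm h1

variable {F L : Type*} [Field F] [Field L] [Algebra F L] {σ : Type*}

/-- Units of `F[σ]` are detected after an injective base change. -/
theorem isUnit_map_iff (P : MvPolynomial σ F) :
    IsUnit (map (algebraMap F L) P) ↔ IsUnit P := by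
  have hι : Function.Injective (algebraMap F L) := (algebraMap F L).injective
  rw [isUnit_iff_totalDegree_of_isReduced, isUnit_iff_totalDegree_of_isReduced, coeff_map,
    isUnit_iff_ne_zero, isUnit_iff_ne_zero, map_ne_zero_iff _ hι]
  simp only [totalDegree, support_map_of_injective _ hι]

/-- **Absolute irreducibility over an algebraically closed field.** If `F` is algebraically
closed and `R ∈ F[σ]` is irreducible, then `R` remains irreducible in `L[σ]` for every field
extension `L / F` (folklore; the specialisation proof via the Nullstellensatz). -/
theorem irreducible_map_of_isAlgClosed [IsAlgClosed F] {R : MvPolynomial σ F}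
    (hR : Irreducible R) : Irreducible (map (algebraMap F L) R) := by
  classical
  have hι : Function.Injective (algebraMap F L) := (algebraMap F L).injective
  refine ⟨fun hu => hR.not_isUnit ((isUnit_map_iff R).mp hu), ?_⟩
  intro G H hGH
  by_contra hcon
  rw [not_or] at hcon
  obtain ⟨hGu, hHu⟩ := hcon
  have hR0 : map (algebraMap F L) R ≠ 0 := by
    intro h0
    exact hR.ne_zero ((map_injective _ hι) (by rw [h0, map_zero]))
  have hG0 : G ≠ 0 := by rintro rfl; exact hR0 (by rw [hGH, zero_mul])
  have hH0 : H ≠ 0 := by rintro rfl; exact hR0 (by rw [hGH, mul_zero])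
  -- top-degree monomials of `G` and `H`
  obtain ⟨mG, hmG, hdegG⟩ := Finset.exists_mem_eq_sup G.support
    (support_nonempty.mpr hG0) (fun s => s.sum fun _ e => e)
  obtain ⟨mH, hmH, hdegH⟩ := Finset.exists_mem_eq_sup H.support
    (support_nonempty.mpr hH0) (fun s => s.sum fun _ e => e)
  have hGdeg : G.totalDegree ≠ 0 := by
    intro h0
    apply hGu
    rw [isUnit_iff_totalDegree_of_isReduced, isUnit_iff_ne_zero]
    refine ⟨?_, h0⟩
    rw [totalDegree_eq_zero_iff_eq_C] at h0
    intro hc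
    apply hG0
    rw [h0, hc, C_0]
  have hHdeg : H.totalDegree ≠ 0 := by
    intro h0
    apply hHu
    rw [isUnit_iff_totalDegree_of_isReduced, isUnit_iff_ne_zero]
    refine ⟨?_, h0⟩
    rw [totalDegree_eq_zero_iff_eq_C] at h0
    intro hc
    apply hH0
    rw [h0, hc, C_0]
  -- the finitely generated subalgebra containing all coefficients
  let S : Finset L := G.coeffs ∪ H.coeffs
  let A : Subalgebra F L := Algebra.adjoin F (S : Set L)
  haveI : Algebra.FiniteType F A :=
    (Subalgebra.fg_iff_finiteType _).mp (Subalgebra.fg_adjoin_finset S)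
  have hArange : Set.range (algebraMap A L) = (A : Set L) := by
    ext x
    constructor
    · rintro ⟨y, rfl⟩; exact y.2
    · intro hx; exact ⟨⟨x, hx⟩, rfl⟩
  have hGA : G ∈ Set.range (map (algebraMap A L)) := by
    rw [mem_range_map_iff_coeffs_subset, hArange]
    intro x hx
    apply Algebra.subset_adjoin
    simp only [S, Finset.coe_union, Set.mem_union]
    exact Or.inl hx
  have hHA : H ∈ Set.range (map (algebraMap A L)) := by
    rw [mem_range_map_iff_coeffs_subset, hArange]
    intro x hx
    apply Algebra.subset_adjoin
    simp only [S, Finset.coe_union, Set.mem_union]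
    exact Or.inr hx
  obtain ⟨GA, hGA⟩ := hGA
  obtain ⟨HA, hHA⟩ := hHA
  have hAinj : Function.Injective (algebraMap A L) := Subtype.val_injective
  have hprod : GA * HA = map (algebraMap F A) R := by
    apply map_injective _ hAinj
    rw [map_mul (map (algebraMap (↥A) L)), hGA, hHA, ← hGH, map_map, ← IsScalarTower.algebraMap_eq]
  -- nonzero top coefficients in `A`
  have hcG : GA.coeff mG ≠ 0 := by
    intro h0
    have : G.coeff mG = 0 := by rw [← hGA, coeff_map, h0, map_zero]
    exact (mem_support_iff.mp hmG) this
  have hcH : HA.coeff mH ≠ 0 := by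
    intro h0
    have : H.coeff mH = 0 := by rw [← hHA, coeff_map, h0, map_zero]
    exact (mem_support_iff.mp hmH) this
  obtain ⟨ψ, hψ⟩ := exists_algHom_apply_ne_zero (F := F) (mul_ne_zero hcG hcH)
  rw [map_mul] at hψ
  have hψG : ψ (GA.coeff mG) ≠ 0 := left_ne_zero_of_mul hψ
  have hψH : ψ (HA.coeff mH) ≠ 0 := right_ne_zero_of_mul hψ
  -- specialise the factorisation
  have hspec : map (ψ : A →+* F) GA * map (ψ : A →+* F) HA = R := by
    rw [← map_mul (map (ψ : ↥A →+* F)), hprod, map_map, AlgHom.comp_algebraMap, Algebra.algebraMap_self,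
      map_id]
  rcases hR.isUnit_or_isUnit hspec.symm with hu | hu
  · rw [isUnit_iff_totalDegree_of_isReduced] at hu
    have hmem : mG ∈ (map (ψ : A →+* F) GA).support := by
      rw [mem_support_iff, coeff_map]; exact hψG
    have := le_totalDegree hmem
    rw [hu.2, ← hdegG] at this
    exact hGdeg (Nat.le_zero.mp this)
  · rw [isUnit_iff_totalDegree_of_isReduced] at hu
    have hmem : mH ∈ (map (ψ : A →+* F) HA).support := by
      rw [mem_support_iff, coeff_map]; exact hψH
    have := le_totalDegree hmem
    rw [hu.2, ← hdegH] at this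
    exact hHdeg (Nat.le_zero.mp this)

end Summit.Schanuel.Schanuel.Theorems.RigidCore.TwoLogs
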